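import Literature.AlgebraicGeometry.HodgeTheory.WeilClassesFieldGeneratorChange
import Literature.AlgebraicGeometry.HodgeTheory.WeilClassesMoonenZarhinCriterionHolds
import HarnessLib

/-!
# Weil classes of a SUBFIELD `F = ℚ(S(φ)) ⊆ F′ = ℚ(φ)`, II: `W_F` lies in the span of the exterior
# products of elements of `W_{F′}` (Moonen–Zarhin 1998, Remark (1), last sentence)

Layer `Literature/AlgebraicGeometry/HodgeTheory`, theorem-only companion of `WeilClassesFieldGeneratorChange`
(`ψ = S(φ)` with `S` INJECTIVE on the roots: same field, same carriers) and of `WeilClassesFieldSubfield`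
(`S` arbitrary: the multiplicities of the subfield `F = ℚ(S(φ))` add along the fibres of `Σ_{F′} → Σ_F`, so
`W_{F′}` Hodge ⟹ `W_F` Hodge).  THIS file proves the SECOND mechanism of Moonen–Zarhin's Remark (1) on the
carriers `pullbackEigenclasses` / `weilClassesField`: the line of `W_F ⊗ ℂ` above an embedding `μ` of `F` is the
cup product of the lines of `W_{F′} ⊗ ℂ` above the embeddings `ρ` of `F′` over `μ`.

PRINTED STATEMENT.  B. J. J. Moonen – Yu. G. Zarhin, *Weil classes on abelian varieties*, J. reine angew. Math. 496
(1998) 83–92 = arXiv:alg-geom/9612017 (held text `paper:arxiv-alg-geom_9612017`), Introduction (chunk p0001): «The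
action of `F` on `V_X` gives a decomposition `V_ℂ = ⊕_{σ ∈ Σ_F} V_{ℂ,σ}` …
`W_F ⊗ ℂ = (⋀^r_F V_X) ⊗ ℂ = ⊕_{σ ∈ Σ_F} ⋀^r_ℂ V_{ℂ,σ}`»; section «In practice, the condition …», Remark **(1)**
(chunk p0004): «Suppose we have two subfields `F ⊆ F′ ⊆ End⁰(X)` … Furthermore, if `F ⊆ F′` then we have the
implication `W_{F′}` consists of decomposable Hodge classes ⟹ `W_F` consists of decomposable Hodge classes.  This is
a direct consequence of Criterion (crit2).  It can also be seen more directly, by using that **`W_F` is contained in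
the vector subspace generated by exterior products of elements of `W_{F′}`**.»
The mechanism: for `τ ∈ Σ_F`, `V_{ℂ,τ} = ⊕_{τ′ | τ} V_{ℂ,τ′}`, hence
`⋀^{r_F} V_{ℂ,τ} = ⊗_{τ′ | τ} ⋀^{r_{F′}} V_{ℂ,τ′}` (`r_F = [F′:F] · r_{F′}`), i.e. the `W_F`-line above `τ` is the
exterior (cup) product of the `W_{F′}`-lines above the `τ′` over `τ`.

WHAT IS PROVED (theorems only; no definition, no named fact).  Data: `φ : A ⟶ A` with `P(φ) = 0` in `End A`,
`P ∈ ℤ[T]` irreducible over `ℚ`; `ψ : A ⟶ A` with `ψ = S(φ)` in `End A`, `S ∈ ℤ[T]` arbitrary (so `F = ℚ(ψ) ⊆ F′ = ℚ(φ)`);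
the line of `W_{F′} ⊗ ℂ` above `ρ` in degree `k` is the carrier `pullbackEigenclasses A φ k ((x + yρ)^k)` (`= ⋀^k V_ρ(φ)`
for `k = dim V_ρ(φ)`), that of `W_F ⊗ ℂ` above `μ` is `pullbackEigenclasses A ψ m ((x + yμ)^m)`.
* §1 **`pullbackEigenclasses_pow_le_of_eq_eval₂`** — `⋀^k V_ρ(φ) ⊆` the `ψ`-eigenclasses of character
  `(x + y S(ρ))^k`, for every `k` and `ρ` (a wedge monomial of `φ`-eigenvectors of eigenvalue `ρ` is a wedge
  monomial of `ψ`-eigenvectors of eigenvalue `S(ρ)`).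
* §2 **`cupProduct_mem_pullbackEigenclasses_of_eq_eval₂`** — for `ρ₁, ρ₂` above `μ` (`S(ρ₁) = S(ρ₂) = μ`) and
  classes `a ∈ ⋀^k V_{ρ₁}(φ)`-line, `b ∈ ⋀^l V_{ρ₂}(φ)`-line: `a ⌣ b` lies in the `ψ`-line of character
  `(x + yμ)^{k+l}`; `cupPowOne_mem_pullbackEigenclasses_pow_of_eq_eval₂` — the same for an iterated cup product
  of `φ`-EIGENVECTORS with eigenvalues above `μ` (any number of factors).
* §3 **`pullbackEigenclasses_pow_eq_span_cupProduct_of_eq_eval₂`** — THE `W_F`-LINE ABOVE `μ` IS THE CUP PRODUCT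
  OF THE `W_{F′}`-LINES ABOVE THE FIBRE, for a two-element fibre: if the roots of `P` above `μ` are among
  `ρ₁ ≠ ρ₂` (`S(ρ₁) = S(ρ₂) = μ`), `k = dim V_{ρ₁}(φ)`, `l = dim V_{ρ₂}(φ)`, and `a ≠ 0`, `b ≠ 0` lie on the two
  `W_{F′}`-lines, then `pullbackEigenclasses A ψ (k + l) ((x + yμ)^{k+l}) = ℂ · (a ⌣ b)` (and `a ⌣ b ≠ 0`:
  `a`, `b` are multiples of top wedges of bases of `V_{ρ₁}`, `V_{ρ₂}`, whose product is the top wedge of a basis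
  of `V_{ρ₁} ⊕ V_{ρ₂}`, non-zero as `H•(A) = ⋀• H¹`; the `ψ`-line has dimension `≤ 1` because
  `V_μ(ψ) ⊆ V_{ρ₁} ⊕ V_{ρ₂}` has dimension `≤ k + l`).
* §4 **`weilClassesField_le_span_cupProduct_of_eq_eval₂`** — MOONEN–ZARHIN'S SENTENCE for `[F′:F] = 2`: with
  `P` monic of degree `e`, `e·r = 2 dim A` (so `dim V_ρ(φ) = r` at every root), if every root `μ` of `Q ∈ ℤ[T]`
  has exactly two roots of `P` above it, then
  `weilClassesField A ψ Q (r + r) ⊆ span_ℂ {a ⌣ b | a, b ∈ weilClassesField A φ P r}`.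

Not treated here: fibres with more than two elements at the level of §3–§4 (the iterated statement is §2's
`cupPowOne_mem_pullbackEigenclasses_pow_of_eq_eval₂` on eigenvectors); the «decomposable Hodge classes»
implication itself (the tree has no carrier for Moonen–Zarhin's algebra `D` of divisor classes of `X`).

No `sorry`; axioms `propext`, `Classical.choice`, `Quot.sound`.

## References
* [MoonenZarhin1998WeilClasses] B. J. J. Moonen, Yu. G. Zarhin, *Weil classes on abelian varieties*, J. reine angew.
  Math. 496 (1998) 83–92 = arXiv:alg-geom/9612017: Introduction (`W_F ⊗ ℂ = ⊕_σ ⋀^r V_{ℂ,σ}`; chunk p0001) and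
  section «In practice…», Remark (1), last sentence (chunk p0004).
* [Deligne1982HodgeCycles] P. Deligne (notes by J. S. Milne), *Hodge cycles on abelian varieties*, LNM 900 (1982), §4
  (4.3)–(4.4) (PDF p. 46: `H¹_B ⊗ ℂ = ⊕_σ H¹_{B,σ}`, `⋀^d_{E ⊗ ℂ} = ⊕_σ ⋀^d H¹_{B,σ}`).
* [vanGeemen1994HodgeAV] B. van Geemen, *An introduction to the Hodge conjecture for abelian varieties*, LNM 1594
  (1994), 4.8–4.9 and proof of Thm. 6.12 (wedges of eigenvectors).
* [LangeBirkenhake1992] H. Lange, Ch. Birkenhake, *Complex Abelian Varieties* (1992), §1.1 and Lemma 1.1.17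
  (`H•(X; ℂ) = ⋀• H¹`).
* [HatcherAT2002] A. Hatcher, *Algebraic Topology* (2002), §3.2 Prop. 3.10 (naturality and bilinearity of `⌣`).
-/

noncomputable section

open CategoryTheory Polynomial

namespace Literature.AlgebraicGeometry.HodgeTheory

section HodgeTheory

open Literature.AlgebraicTopology.SingularHomology
open Literature.AlgebraicGeometry.Motives (IsSmoothProjective)

/-! ### §0 Folklore (private) -/

section Folklore

/-- In a subspace of dimension `≤ 1`, every vector is a multiple of any non-zero vector. [folklore] -/
private theorem exists_eq_smul_of_finrank_le_one {M : Type*} [AddCommGroup M] [Module ℂ M]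
    [FiniteDimensional ℂ M] {E : Submodule ℂ M} (hE : Module.finrank ℂ E ≤ 1) {x y : M}
    (hx : x ∈ E) (hx0 : x ≠ 0) (hy : y ∈ E) : ∃ t : ℂ, y = t • x := by
  have hpos : 0 < Module.finrank ℂ E :=
    Module.finrank_pos_iff_exists_ne_zero.2 ⟨⟨x, hx⟩, fun h => hx0 (congrArg Subtype.val h)⟩
  obtain ⟨t, ht⟩ := (finrank_eq_one_iff_of_nonzero' (⟨x, hx⟩ : E)
    (fun h => hx0 (congrArg Subtype.val h))).1 (le_antisymm hE hpos) ⟨y, hy⟩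
  exact ⟨t, by simpa using (congrArg Subtype.val ht).symm⟩

/-- A subspace of dimension `≤ 1` containing a non-zero vector is the line it spans. [folklore] -/
private theorem eq_span_singleton_of_finrank_le_one {M : Type*} [AddCommGroup M] [Module ℂ M]
    [FiniteDimensional ℂ M] {E : Submodule ℂ M} (hE : Module.finrank ℂ E ≤ 1) {x : M}
    (hx : x ∈ E) (hx0 : x ≠ 0) : E = Submodule.span ℂ {x} := by
  refine le_antisymm (fun y hy => ?_) ((Submodule.span_singleton_le_iff_mem x E).2 hx)
  obtain ⟨t, rfl⟩ := exists_eq_smul_of_finrank_le_one hE hx hx0 hy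
  exact Submodule.smul_mem _ t (Submodule.mem_span_singleton_self x)

/-- Concatenating linearly independent families spanning disjoint subspaces gives a linearly independent
family. [folklore] -/
private theorem linearIndependent_append_of_disjoint {M : Type*} [AddCommGroup M] [Module ℂ M] {k l : ℕ}
    {u : Fin k → M} {v : Fin l → M} (hu : LinearIndependent ℂ u) (hv : LinearIndependent ℂ v)
    (h : Disjoint (Submodule.span ℂ (Set.range u)) (Submodule.span ℂ (Set.range v))) :
    LinearIndependent ℂ (Fin.append u v) := by
  rw [← linearIndependent_equiv finSumFinEquiv]
  have e : Fin.append u v ∘ ⇑(finSumFinEquiv : Fin k ⊕ Fin l ≃ Fin (k + l)) = Sum.elim u v := by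
    funext x
    rcases x with i | j
    · simp
    · simp
  rw [e]
  exact hu.sum_type hv h

end Folklore

variable {A : Motives.AbelianVariety ℂ} {φ ψ : A ⟶ A} {P S : Polynomial ℤ}

/-! ### §0′ Semisimplicity of `φ^*` and of `ψ^* = S(φ^*)` on `H¹` (private) -/

section Semisimple

/-- `φ^*` on `H¹(A(ℂ); ℂ)` is semisimple: it is killed by the separable polynomial `P`. [folklore] -/
private theorem isSemisimple_map_one (hPirr : Irreducible (P.map (Int.castRingHom ℚ)))
    (hφ : Polynomial.eval₂ (Int.castRingHom (CategoryTheory.End A)) (φ : CategoryTheory.End A) P = 0) :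
    Module.End.IsSemisimple (complexBetti.map φ.hom.hom.hom 1).hom := by
  haveI := finite_complexBetti_abelianVariety A 1
  have hsepC : (P.map (Int.castRingHom ℂ)).Separable := by
    rw [map_castRingHom_complex_eq]; exact hPirr.separable.map
  exact Module.End.isSemisimple_of_squarefree_aeval_eq_zero hsepC.squarefree
    (aeval_hom_complexBetti_map_one_eq_zero hφ)

/-- `ψ^* = S(φ^*)` on `H¹(A(ℂ); ℂ)` is semisimple (a polynomial in a semisimple endomorphism). [folklore] -/
private theorem isSemisimple_map_one_of_eq_eval₂ (hPirr : Irreducible (P.map (Int.castRingHom ℚ)))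
    (hφ : Polynomial.eval₂ (Int.castRingHom (CategoryTheory.End A)) (φ : CategoryTheory.End A) P = 0)
    (hψ : (ψ : CategoryTheory.End A) =
      Polynomial.eval₂ (Int.castRingHom (CategoryTheory.End A)) (φ : CategoryTheory.End A) S) :
    Module.End.IsSemisimple (complexBetti.map ψ.hom.hom.hom 1).hom := by
  haveI := finite_complexBetti_abelianVariety A 1
  rw [hom_complexBetti_map_one_of_eq_eval₂ hψ]
  exact (isSemisimple_map_one hPirr hφ).aeval _

end Semisimple

/-! ### §1 The `W_{F′}`-line above `ρ` consists of `ψ`-eigenclasses of character `(x + y S(ρ))^k` -/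

section LineBelow

/-- **`⋀^k V_ρ(φ)` consists of `ψ = S(φ)`-eigenclasses of character `(x + y·S(ρ))^k`**: for `P` irreducible over `ℚ`
with `P(φ) = 0`, `ψ = S(φ)`, every `k` and every `ρ ∈ ℂ`,
`pullbackEigenclasses A φ k ((x + yρ)^k) ≤ pullbackEigenclasses A ψ k ((x + y S(ρ))^k)` — in a `φ`-eigenbasis
`bᵢ` (`φ^* bᵢ = λᵢ bᵢ`, hence `ψ^* bᵢ = S(λᵢ) bᵢ`) the left side is spanned by the wedge monomials `b_T` with all
`λᵢ = ρ` on `T`, each of which has all `S(λᵢ) = S(ρ)` on `T` (`pullbackEigenclasses_pow_eq_span_wedge` twice).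
[cite: MoonenZarhin1998WeilClasses, Introduction (W_F ⊗ ℂ = ⊕_σ ⋀^r V_{ℂ,σ}) and Remark (1) (chunks p0001, p0004)]
[cite: vanGeemen1994HodgeAV, 4.9] -/
theorem pullbackEigenclasses_pow_le_of_eq_eval₂ (hPirr : Irreducible (P.map (Int.castRingHom ℚ)))
    (hφ : Polynomial.eval₂ (Int.castRingHom (CategoryTheory.End A)) (φ : CategoryTheory.End A) P = 0)
    (hψ : (ψ : CategoryTheory.End A) =
      Polynomial.eval₂ (Int.castRingHom (CategoryTheory.End A)) (φ : CategoryTheory.End A) S)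
    (k : ℕ) (ρ : ℂ) :
    pullbackEigenclasses A φ k (fun x y => ((x : ℂ) + (y : ℂ) * ρ) ^ k) ≤
      pullbackEigenclasses A ψ k
        (fun x y => ((x : ℂ) + (y : ℂ) * Polynomial.eval₂ (Int.castRingHom ℂ) ρ S) ^ k) := by
  obtain ⟨N, b, lam, -, hb⟩ := exists_eigenbasis_complexBetti_one hPirr hφ
  have hb' : ∀ i, b i ∈ Module.End.eigenspace (complexBetti.map ψ.hom.hom.hom 1).hom
      (Polynomial.eval₂ (Int.castRingHom ℂ) (lam i) S) := fun i => mem_eigenspace_map_one_of_eq_eval₂ hψ (hb i)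
  rw [pullbackEigenclasses_pow_eq_span_wedge b lam hb k ρ,
    pullbackEigenclasses_pow_eq_span_wedge b (fun i => Polynomial.eval₂ (Int.castRingHom ℂ) (lam i) S) hb' k
      (Polynomial.eval₂ (Int.castRingHom ℂ) ρ S)]
  refine Submodule.span_mono (Set.image_mono fun T hT => ?_)
  simp only [Set.mem_setOf_eq] at hT ⊢
  intro i
  rw [hT i]

end LineBelow

/-! ### §2 Cup products of classes of the `W_{F′}`-lines above `μ` lie on the `W_F`-line above `μ` -/

section Products

/-- **`⋀^k V_{ρ₁}(φ) ⌣ ⋀^l V_{ρ₂}(φ) ⊆ (⋀^{k+l} V_μ(ψ))`-line for `S(ρ₁) = S(ρ₂) = μ`**: the cup product of a class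
of the `W_{F′}`-line above `ρ₁` (degree `k`) and one above `ρ₂` (degree `l`) is a `ψ`-eigenclass of character
`(x + yμ)^{k+l}` (§1 and the multiplicativity of the pull-backs, `cupProduct_mem_pullbackEigenclasses`) — the
carrier form of «`W_F` is contained in the vector subspace generated by exterior products of elements of
`W_{F′}`», containment of the products. [cite: MoonenZarhin1998WeilClasses, Remark (1) (chunk p0004)]
[cite: HatcherAT2002, §3.2 Prop. 3.10] -/
theorem cupProduct_mem_pullbackEigenclasses_of_eq_eval₂ (hPirr : Irreducible (P.map (Int.castRingHom ℚ)))
    (hφ : Polynomial.eval₂ (Int.castRingHom (CategoryTheory.End A)) (φ : CategoryTheory.End A) P = 0)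
    (hψ : (ψ : CategoryTheory.End A) =
      Polynomial.eval₂ (Int.castRingHom (CategoryTheory.End A)) (φ : CategoryTheory.End A) S)
    {ρ₁ ρ₂ μ : ℂ} (h₁ : Polynomial.eval₂ (Int.castRingHom ℂ) ρ₁ S = μ)
    (h₂ : Polynomial.eval₂ (Int.castRingHom ℂ) ρ₂ S = μ) {k l m : ℕ} (h : k + l = m)
    {a : complexBetti A.X k} {b : complexBetti A.X l}
    (ha : a ∈ pullbackEigenclasses A φ k (fun x y => ((x : ℂ) + (y : ℂ) * ρ₁) ^ k))
    (hb : b ∈ pullbackEigenclasses A φ l (fun x y => ((x : ℂ) + (y : ℂ) * ρ₂) ^ l)) :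
    cupProduct h a b ∈ pullbackEigenclasses A ψ m (fun x y => ((x : ℂ) + (y : ℂ) * μ) ^ m) := by
  have ha' := pullbackEigenclasses_pow_le_of_eq_eval₂ hPirr hφ hψ k ρ₁ ha
  have hb' := pullbackEigenclasses_pow_le_of_eq_eval₂ hPirr hφ hψ l ρ₂ hb
  rw [h₁] at ha'
  rw [h₂] at hb'
  have key := cupProduct_mem_pullbackEigenclasses h ha' hb'
  have e : (fun x y : ℕ => ((x : ℂ) + (y : ℂ) * μ) ^ k * ((x : ℂ) + (y : ℂ) * μ) ^ l) =
      fun x y : ℕ => ((x : ℂ) + (y : ℂ) * μ) ^ m := by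
    funext x y
    rw [← pow_add, h]
  rw [e] at key
  exact key

/-- **`w₁ ⌣ ⋯ ⌣ w_m` lies on the `W_F`-line above `μ` for `φ`-eigenvectors `wᵢ ∈ V_{ρᵢ}(φ)` with all `S(ρᵢ) = μ`**
(any number of factors from any lines of the fibre): each `wᵢ` is a `ψ`-eigenvector of eigenvalue `S(ρᵢ) = μ`, and
an iterated cup product of `μ`-eigenvectors of `ψ^*` has character `(x + yμ)^m`
(`cupPowOne_mem_pullbackEigenclasses_pow`). [cite: MoonenZarhin1998WeilClasses, Remark (1) (chunk p0004)]
[cite: vanGeemen1994HodgeAV, 4.9 and proof of Thm. 6.12] -/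
theorem cupPowOne_mem_pullbackEigenclasses_pow_of_eq_eval₂
    (hψ : (ψ : CategoryTheory.End A) =
      Polynomial.eval₂ (Int.castRingHom (CategoryTheory.End A)) (φ : CategoryTheory.End A) S)
    {m : ℕ} {μ : ℂ} {ρ : Fin m → ℂ} (hρ : ∀ i, Polynomial.eval₂ (Int.castRingHom ℂ) (ρ i) S = μ)
    {w : Fin m → complexBetti A.X 1}
    (hw : ∀ i, w i ∈ Module.End.eigenspace (complexBetti.map φ.hom.hom.hom 1).hom (ρ i)) :
    cupPowOne ℂ (Motives.ComplexPoints A.X) m w ∈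
      pullbackEigenclasses A ψ m (fun x y => ((x : ℂ) + (y : ℂ) * μ) ^ m) := by
  refine cupPowOne_mem_pullbackEigenclasses_pow ψ fun i => ?_
  have h := mem_eigenspace_map_one_of_eq_eval₂ hψ (hw i)
  rwa [hρ i] at h

end Products

/-! ### §3 The `W_F`-line above `μ` is the cup product of the `W_{F′}`-lines above a two-element fibre -/

section TwoElementFibre

/-- **THE `W_F`-LINE ABOVE `μ` IS THE CUP PRODUCT OF THE TWO `W_{F′}`-LINES ABOVE IT.**  Let `P` be irreducible over
`ℚ` with `P(φ) = 0`, `ψ = S(φ)`, and let `μ ∈ ℂ` be such that every root of `P` above `μ` is `ρ₁` or `ρ₂`, where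
`ρ₁ ≠ ρ₂` and `S(ρ₁) = S(ρ₂) = μ`; put `k = dim V_{ρ₁}(φ)`, `l = dim V_{ρ₂}(φ)`.  Then for any NON-ZERO classes `a`
on the line `⋀^k V_{ρ₁}(φ)` and `b` on the line `⋀^l V_{ρ₂}(φ)`:
`pullbackEigenclasses A ψ (k + l) ((x + yμ)^{k+l}) = ℂ · (a ⌣ b)`.
Proof («`⋀^{r_F} V_{ℂ,τ} = ⊗_{τ′|τ} ⋀^{r_{F′}} V_{ℂ,τ′}`»): `a = s · (u₁ ⌣ ⋯ ⌣ u_k)`, `b = t · (v₁ ⌣ ⋯ ⌣ v_l)` for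
bases `u`, `v` of `V_{ρ₁}`, `V_{ρ₂}` (the `φ`-lines have dimension `≤ 1`, `finrank_pullbackEigenclasses_pow_le_one`),
so `a ⌣ b = st · (u₁ ⌣ ⋯ ⌣ u_k ⌣ v₁ ⌣ ⋯ ⌣ v_l) ≠ 0` — the concatenated family is linearly independent
(`V_{ρ₁} ∩ V_{ρ₂} = 0`) and `H•(A(ℂ); ℂ) = ⋀• H¹` (`cupPowOne_ne_zero_of_linearIndependent`); it lies on the `ψ`-line
(§2), which has dimension `≤ 1` since `V_μ(ψ) ⊆ V_{ρ₁} ⊕ V_{ρ₂}` has dimension `≤ k + l`.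
[cite: MoonenZarhin1998WeilClasses, Introduction and Remark (1), last sentence (chunks p0001, p0004)]
[cite: Deligne1982HodgeCycles, §4 (4.3)–(4.4) (PDF p. 46)] [cite: LangeBirkenhake1992, Lemma 1.1.17] -/
theorem pullbackEigenclasses_pow_eq_span_cupProduct_of_eq_eval₂
    (hPirr : Irreducible (P.map (Int.castRingHom ℚ)))
    (hφ : Polynomial.eval₂ (Int.castRingHom (CategoryTheory.End A)) (φ : CategoryTheory.End A) P = 0)
    (hψ : (ψ : CategoryTheory.End A) =
      Polynomial.eval₂ (Int.castRingHom (CategoryTheory.End A)) (φ : CategoryTheory.End A) S)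
    {ρ₁ ρ₂ μ : ℂ} (h₁ : Polynomial.eval₂ (Int.castRingHom ℂ) ρ₁ S = μ)
    (h₂ : Polynomial.eval₂ (Int.castRingHom ℂ) ρ₂ S = μ) (hne : ρ₁ ≠ ρ₂)
    (hfib : ∀ ρ : ℂ, Polynomial.eval₂ (Int.castRingHom ℂ) ρ P = 0 →
      Polynomial.eval₂ (Int.castRingHom ℂ) ρ S = μ → ρ = ρ₁ ∨ ρ = ρ₂)
    {k l m : ℕ}
    (hk : Module.finrank ℂ ↥(Module.End.eigenspace (complexBetti.map φ.hom.hom.hom 1).hom ρ₁) = k)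
    (hl : Module.finrank ℂ ↥(Module.End.eigenspace (complexBetti.map φ.hom.hom.hom 1).hom ρ₂) = l)
    (h : k + l = m) {a : complexBetti A.X k} {b : complexBetti A.X l}
    (ha : a ∈ pullbackEigenclasses A φ k (fun x y => ((x : ℂ) + (y : ℂ) * ρ₁) ^ k)) (ha0 : a ≠ 0)
    (hb : b ∈ pullbackEigenclasses A φ l (fun x y => ((x : ℂ) + (y : ℂ) * ρ₂) ^ l)) (hb0 : b ≠ 0) :
    pullbackEigenclasses A ψ m (fun x y => ((x : ℂ) + (y : ℂ) * μ) ^ m) =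
      Submodule.span ℂ {cupProduct h a b} := by
  subst h
  haveI := finite_complexBetti_abelianVariety A 1
  haveI := finite_complexBetti_abelianVariety A k
  haveI := finite_complexBetti_abelianVariety A l
  haveI := finite_complexBetti_abelianVariety A (k + l)
  have hssφ := isSemisimple_map_one hPirr hφ
  have hssψ := isSemisimple_map_one_of_eq_eval₂ hPirr hφ hψ
  -- bases of the two eigenspaces, read in `H¹`
  let E₁ := Module.End.eigenspace (complexBetti.map φ.hom.hom.hom 1).hom ρ₁
  let E₂ := Module.End.eigenspace (complexBetti.map φ.hom.hom.hom 1).hom ρ₂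
  let u : Module.Basis (Fin k) ℂ E₁ := (Module.finBasis ℂ E₁).reindex (finCongr hk)
  let v : Module.Basis (Fin l) ℂ E₂ := (Module.finBasis ℂ E₂).reindex (finCongr hl)
  have hu : ∀ i, (u i : complexBetti A.X 1) ∈ E₁ := fun i => (u i).2
  have hv : ∀ j, (v j : complexBetti A.X 1) ∈ E₂ := fun j => (v j).2
  have hli_u : LinearIndependent ℂ (fun i => (u i : complexBetti A.X 1)) :=
    u.linearIndependent.map' E₁.subtype E₁.ker_subtype
  have hli_v : LinearIndependent ℂ (fun j => (v j : complexBetti A.X 1)) :=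
    v.linearIndependent.map' E₂.subtype E₂.ker_subtype
  have hdisj : Disjoint E₁ E₂ :=
    (Module.End.eigenspaces_iSupIndep (complexBetti.map φ.hom.hom.hom 1).hom).pairwiseDisjoint hne
  have hspan_u : Submodule.span ℂ (Set.range fun i => (u i : complexBetti A.X 1)) ≤ E₁ :=
    Submodule.span_le.2 (by rintro _ ⟨i, rfl⟩; exact hu i)
  have hspan_v : Submodule.span ℂ (Set.range fun j => (v j : complexBetti A.X 1)) ≤ E₂ :=
    Submodule.span_le.2 (by rintro _ ⟨j, rfl⟩; exact hv j)
  have hli : LinearIndependent ℂ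
      (Fin.append (fun i => (u i : complexBetti A.X 1)) (fun j => (v j : complexBetti A.X 1))) :=
    linearIndependent_append_of_disjoint hli_u hli_v (hdisj.mono hspan_u hspan_v)
  -- the top wedges `a₀ = u₁ ⌣ ⋯ ⌣ u_k`, `b₀ = v₁ ⌣ ⋯ ⌣ v_l` and their product
  have ha₀ : cupPowOne ℂ (Motives.ComplexPoints A.X) k (fun i => (u i : complexBetti A.X 1)) ∈
      pullbackEigenclasses A φ k (fun x y => ((x : ℂ) + (y : ℂ) * ρ₁) ^ k) :=
    cupPowOne_mem_pullbackEigenclasses_pow φ hu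
  have hb₀ : cupPowOne ℂ (Motives.ComplexPoints A.X) l (fun j => (v j : complexBetti A.X 1)) ∈
      pullbackEigenclasses A φ l (fun x y => ((x : ℂ) + (y : ℂ) * ρ₂) ^ l) :=
    cupPowOne_mem_pullbackEigenclasses_pow φ hv
  have ha₀0 : cupPowOne ℂ (Motives.ComplexPoints A.X) k (fun i => (u i : complexBetti A.X 1)) ≠ 0 :=
    cupPowOne_ne_zero_of_linearIndependent A hli_u
  have hb₀0 : cupPowOne ℂ (Motives.ComplexPoints A.X) l (fun j => (v j : complexBetti A.X 1)) ≠ 0 :=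
    cupPowOne_ne_zero_of_linearIndependent A hli_v
  have hprod : cupProduct rfl
      (cupPowOne ℂ (Motives.ComplexPoints A.X) k (fun i => (u i : complexBetti A.X 1)))
      (cupPowOne ℂ (Motives.ComplexPoints A.X) l (fun j => (v j : complexBetti A.X 1))) ≠ 0 := by
    rw [cupProduct_cupPowOne_cupPowOne]
    exact cupPowOne_ne_zero_of_linearIndependent A hli
  -- `a`, `b` are multiples of the top wedges (the `φ`-lines have dimension `≤ 1`)
  have hle₁ := (finrank_pullbackEigenclasses_pow_le_one (A := A) (φ := φ) hssφ (N := k) ρ₁ hk.le).1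
  have hle₂ := (finrank_pullbackEigenclasses_pow_le_one (A := A) (φ := φ) hssφ (N := l) ρ₂ hl.le).1
  obtain ⟨s, hs⟩ := exists_eq_smul_of_finrank_le_one hle₁ ha₀ ha₀0 ha
  obtain ⟨t, ht⟩ := exists_eq_smul_of_finrank_le_one hle₂ hb₀ hb₀0 hb
  have hs0 : s ≠ 0 := by
    rintro rfl
    exact ha0 (by rw [hs, zero_smul])
  have ht0 : t ≠ 0 := by
    rintro rfl
    exact hb0 (by rw [ht, zero_smul])
  have hab0 : cupProduct rfl a b ≠ 0 := by
    rw [hs, ht, LinearMap.map_smul₂, map_smul, smul_smul]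
    exact smul_ne_zero (mul_ne_zero hs0 ht0) hprod
  -- the `ψ`-line has dimension `≤ 1`: `V_μ(ψ) ⊆ V_{ρ₁} ⊕ V_{ρ₂}`
  have hVμ : Module.End.eigenspace (complexBetti.map ψ.hom.hom.hom 1).hom μ ≤ E₁ ⊔ E₂ := by
    obtain ⟨N, bb, lam, hlamP, hbb⟩ := exists_eigenbasis_complexBetti_one hPirr hφ
    have hbb' : ∀ i, bb i ∈ Module.End.eigenspace (complexBetti.map ψ.hom.hom.hom 1).hom
        (Polynomial.eval₂ (Int.castRingHom ℂ) (lam i) S) :=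
      fun i => mem_eigenspace_map_one_of_eq_eval₂ hψ (hbb i)
    rw [eigenspace_eq_span_of_eigenbasis bb (fun i => Polynomial.eval₂ (Int.castRingHom ℂ) (lam i) S) _ hbb' μ,
      Submodule.span_le]
    rintro _ ⟨i, hi, rfl⟩
    rcases hfib (lam i) (hlamP i) hi with h | h
    · refine Submodule.mem_sup_left ?_
      have := hbb i
      rwa [h] at this
    · refine Submodule.mem_sup_right ?_
      have := hbb i
      rwa [h] at this
  have hmult : Module.finrank ℂ ↥(Module.End.eigenspace (complexBetti.map ψ.hom.hom.hom 1).hom μ) ≤ k + l := by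
    refine (Submodule.finrank_mono hVμ).trans ?_
    refine (Submodule.finrank_add_le_finrank_add_finrank E₁ E₂).trans ?_
    rw [hk, hl]
  have hle := (finrank_pullbackEigenclasses_pow_le_one (A := A) (φ := ψ) hssψ (N := k + l) μ hmult).1
  exact eq_span_singleton_of_finrank_le_one hle
    (cupProduct_mem_pullbackEigenclasses_of_eq_eval₂ hPirr hφ hψ h₁ h₂ rfl ha hb) hab0

end TwoElementFibre

/-! ### §4 Moonen–Zarhin's sentence for `[F′ : F] = 2`: `W_F ⊗ ℂ ⊆ span {a ⌣ b | a, b ∈ W_{F′} ⊗ ℂ}` -/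

section Subfield

variable {Q : Polynomial ℤ} {e r : ℕ}

/-- **«`W_F` IS CONTAINED IN THE VECTOR SUBSPACE GENERATED BY EXTERIOR PRODUCTS OF ELEMENTS OF `W_{F′}`»
(Moonen–Zarhin 1998, Remark (1)) for a subfield of index two, on the carriers.**  Let `P ∈ ℤ[T]` be monic,
irreducible over `ℚ`, of degree `e`, with `P(φ) = 0` and `e · r = 2 dim A` (so `dim V_ρ(φ) = r` at every root,
`finrank_eigenspace_eq_of_root`), `ψ = S(φ)`, and suppose that above every complex root `μ` of `Q ∈ ℤ[T]` there are
EXACTLY TWO roots of `P` (`S(ρ₁) = S(ρ₂) = μ`, `ρ₁ ≠ ρ₂`, and no other root of `P` maps to `μ`).  Then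
`weilClassesField A ψ Q (r + r) ⊆ span_ℂ {a ⌣ b | a, b ∈ weilClassesField A φ P r}`: the `W_F`-line above each
`μ` is `ℂ · (ω_{ρ₁} ⌣ ω_{ρ₂})` for generators `ω_ρ` of the `W_{F′}`-lines (§3 with
`exists_generator_pullbackEigenclasses_of_root`). [cite: MoonenZarhin1998WeilClasses, Remark (1), last sentence (chunk p0004)]
[cite: Deligne1982HodgeCycles, §4 (4.4) (PDF p. 46)] -/
theorem weilClassesField_le_span_cupProduct_of_eq_eval₂ (hPm : P.Monic) (hPe : P.natDegree = e)
    (hPirr : Irreducible (P.map (Int.castRingHom ℚ)))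
    (hφ : Polynomial.eval₂ (Int.castRingHom (CategoryTheory.End A)) (φ : CategoryTheory.End A) P = 0)
    (her : e * r = 2 * A.dim)
    (hψ : (ψ : CategoryTheory.End A) =
      Polynomial.eval₂ (Int.castRingHom (CategoryTheory.End A)) (φ : CategoryTheory.End A) S)
    (hfib : ∀ μ : ℂ, Polynomial.eval₂ (Int.castRingHom ℂ) μ Q = 0 → ∃ ρ₁ ρ₂ : ℂ, ρ₁ ≠ ρ₂ ∧
      Polynomial.eval₂ (Int.castRingHom ℂ) ρ₁ P = 0 ∧ Polynomial.eval₂ (Int.castRingHom ℂ) ρ₂ P = 0 ∧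
      Polynomial.eval₂ (Int.castRingHom ℂ) ρ₁ S = μ ∧ Polynomial.eval₂ (Int.castRingHom ℂ) ρ₂ S = μ ∧
      ∀ ρ : ℂ, Polynomial.eval₂ (Int.castRingHom ℂ) ρ P = 0 →
        Polynomial.eval₂ (Int.castRingHom ℂ) ρ S = μ → ρ = ρ₁ ∨ ρ = ρ₂) :
    weilClassesField A ψ Q (r + r) ≤
      Submodule.span ℂ (Set.image2 (fun a b => cupProduct rfl a b)
        (weilClassesField A φ P r : Set (complexBetti A.X r)) (weilClassesField A φ P r)) := by
  refine iSup₂_le fun μ hμ => ?_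
  obtain ⟨ρ₁, ρ₂, hne, hρ₁, hρ₂, hS₁, hS₂, honly⟩ := hfib μ hμ
  obtain ⟨ω₁, hω₁, hω₁0, -, -⟩ := exists_generator_pullbackEigenclasses_of_root hPm hPe hPirr hφ her hρ₁
  obtain ⟨ω₂, hω₂, hω₂0, -, -⟩ := exists_generator_pullbackEigenclasses_of_root hPm hPe hPirr hφ her hρ₂
  rw [pullbackEigenclasses_pow_eq_span_cupProduct_of_eq_eval₂ hPirr hφ hψ hS₁ hS₂ hne honly
    (finrank_eigenspace_eq_of_root hPm hPe hPirr hφ her hρ₁) (finrank_eigenspace_eq_of_root hPm hPe hPirr hφ her hρ₂)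
    rfl hω₁ hω₁0 hω₂ hω₂0]
  exact Submodule.span_mono (Set.singleton_subset_iff.2
    (Set.mem_image2_of_mem (pullbackEigenclasses_le_weilClassesField hρ₁ hω₁)
      (pullbackEigenclasses_le_weilClassesField hρ₂ hω₂)))

end Subfield

end HodgeTheory

end Literature.AlgebraicGeometry.HodgeTheory
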